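import Summits.AnomalousDissipation.AnomalousDissipation.Theses.PumpedMirror

/-!
# Birth skeleton for crux `PumpedMirror.MirrorFloorTG` (stmt-AnomalousDissipation-15372)

planner-skel-stmt-AnomalousDissipation-15372-0 · skeleton-register (BC3, one-shot) · 2026-08-17.
Route `route-AnomalousDissipation-PumpedMirror` (rev 2), crux #2 (rank 2, OPEN / open-problem):
the LOW-ENERGY MIRROR FLOOR — for the pinned Taylor–Green force `f_TG` and every energy level
`E > 0`, at every small `ν` ONE cylindrical test functional `Φ₁` and weight `θ₁ ≤ 0` certify
`ε₀ ≤ ν‖∇u‖² + ⟨F_ν(u),Φ₁'(u)⟩ + 2θ₁((u,f_TG) − ν‖∇u‖²)` at every finite-enstrophy K-symmetric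
state `u ∈ H` with `|u|² ≤ E`.

## The line — STRONG DUALITY ON THE MIRROR SLAB (the crux's own "by minimax" sentence, typed)

Read the crux at fixed `(ν, E)` as a game between CERTIFICATES `(Φ, θ ≤ 0)` and RELAXED
STATIONARY K-STATISTICS: Borel probability measures on `H` carried by the MIRROR SLAB
`Fix K ∩ {|u|² ≤ E}` (`mirrorSlab`, verbatim the crux's a.e. K-symmetry clause), of finite mean
enstrophy, annihilating every cylindrical Liouville functional and obeying the one global mean
energy inequality (`IsRelaxedSSSOn`). Weak duality (certificate ⇒ every such statistic dissipates
`≥ ε₀`; FMRT IV / Rosa–Temam Thm 6.3–6.4; the tree's `floorTransfer`) is the easy direction. The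
line bets on the CONVERSE at fixed `ν` — inf-compact ("dissipation is its own tightness") lopsided
minimax on a CLOSED carrier inside a ball, exactly the machinery of the sibling crux line
`Cruxes/FloorCertificate/Lines/floor-minimax-dissipation-tightness.lean` (its S1–S5, stated there
for the Leray ball; here for `S ∩ ball`, `S` closed) — which answers the grounder's objection
(g48-0: "Rosa–Temam Thm 6.2 needs an H-COMPACT carrier; the slab is not compact") by supplying
compactness from the OBJECTIVE (enstrophy sublevel sets of measures are tight by Rellich) rather
than from the carrier. Then the crux is EQUIVALENT (given S1) to ONE physics statement in dual form,
S3 `MirrorLawsLoudTG`: below every energy level `E`, every relaxed stationary K-statistic of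
`NS_ν(f_TG)` is `ε₀(E)`-loud uniformly in `ν < ν₀(E)` — NO QUIET INVARIANT K-LAW (steady corner
line-jet branch, planar-cell shadow branch, quiet eruption cycle, generalized time average, or
non-dynamical relaxed measure) lives in the slab. The transfer is not a costume: S3 is NECESSARY for
the crux by weak duality (integrate the floor against `μ`: Liouville kills the generator term,
`θ ≤ 0` and the energy inequality sign the channel away), and SUFFICIENT only through S1 + S2.

Stub set (3): S1 `stub_floorMinimaxOn` (L, provable now; = sibling S1–S5 with the ball replaced by
`S ∩ ball`, prove once for both cruxes) · S2 `stub_mirrorSlabClosed` (S–M, provable now: the a.e.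
mirror class is closed in `H`) · S3 `stub_mirrorLawsLoudTG` (OPEN; hardest; the crux's physical
content in dual form). Composition `MirrorFloorTG_of : S1 → S2 → S3 → MirrorFloorTG` (hypotheses spelled
through the name-keyed aliases `__Registered.stub_*`, definitionally S1–S3) is kernel-checked (answer
`E ↦ (ε₀(E)/2, ν₀(E))`, margin `δ = ε₀/2`; the admissibility `f_TG ∈ L²` needed by S1 is PROVED here
from the trigonometric-polynomial anatomy of `f_TG`, as in the route's `closes`). `mirrorFloorTG_iff`
records that the vocabulary is DEFINITIONALLY the crux.

Why the dual side is easier (Transfer): the enemy becomes an EXACT object. A finitely supported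
relaxed K-statistic is a convex combination of Diracs at finite-enstrophy steady weak K-states
(localise `Φ` around an atom; landed pattern `EnsembleCeiling/Negative/DiracAtoms`), so the atomic
case of S3 is precisely the route's support item `MirrorSteadyStatesLoudTG`, on which the Kelvin
pump identity `KelvinPumpSteadyTG` (`ν∮_C Δu·dl = −4/π`: every steady K-state carries `1/ν`
curvature on the symmetry skeleton) acts; the class is convex, narrowly closed at fixed `ν`, and
every cylindrical `Φ` is an exact linear constraint on it (e.g. `Φ = (u,f_TG)`:
`‖f_TG‖² = 12π²ν∫(u,f_TG)dμ + ∫b(u,u,f_TG)dμ`, so quiet K-laws must carry the full triple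
correlation `∫b(u,u,f_TG)dμ → 1/4` at bounded energy).

Disproof.lean: none exists for this crux (`ledger crux ls stmt-AnomalousDissipation-15372`: no
workfiles, 2026-08-17) — no `_false_without_<H>` obligation to honour. Negatives index
(`ledger negatives --problem AnomalousDissipation`, 6 items: 14324 ScalarLift2halfD, 0204
CorrelationEnergyUnboundedNeg, 13037 TaylorCertificatePair (pointwise ceiling), 2979/2984
FrustratedForces ceilings/drift, 2859 DebrisQuanta): none is a floor, a duality or a mirror-class
statement; no stub restates one. Landed kills of floor certificates
(`KolmogorovFloor/Negative/QuietPointKill`, `CheapBaseKill`) need a smooth quiet Euler K-point of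
`f_TG`, excluded in `Fix K` by the route's support `NoSmoothMirrorDodgerTG` (Kelvin pump); S3 is a
statement about EXACT relaxed statistics, on which a family of approximate dodgers refutes nothing.
-/

noncomputable section

set_option linter.dupNamespace false

namespace Summit.AnomalousDissipation.AnomalousDissipation.Cruxes.MirrorFloorTG.Birth

open MeasureTheory Filter Topology UnitAddTorus
open scoped InnerProductSpace ENNReal
open Literature.Analysis.FunctionSpaces Literature.Analysis.FluidPDE
open Summit.AnomalousDissipation.AnomalousDissipation.Theses.PumpedMirror

/-- Local notation: real vector fields on `T³`. -/
local notation "Vec3" => (UnitAddTorus (Fin 3)) → (EuclideanSpace ℝ (Fin 3))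
/-- Local notation: `L²(T³; ℝ³)`. -/
local notation "L2" => (Lp (EuclideanSpace ℝ (Fin 3)) 2 (volume : Measure (UnitAddTorus (Fin 3))))
/-- Local notation: the energy space `H` (Borel σ-algebra from `StatisticalSolution.lean`). -/
local notation "H3" => (Torus.energySpace (Fin 3))

/-! ## Vocabulary (definitional abbreviations of the crux's own terms) -/

/-- The PINNED Taylor–Green force `f_TG = (sin 2πx₀ cos 2πx₁ cos 2πx₂, −cos 2πx₀ sin 2πx₁ cos 2πx₂, 0)`
— verbatim the lambda term of the crux (`∀ f, f = f_TG → …`). -/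
def tgForce : Vec3 := fun x =>
  !₂[(fourier 1 (x 0) : ℂ).im * (fourier 1 (x 1) : ℂ).re * (fourier 1 (x 2) : ℂ).re,
    -((fourier 1 (x 0) : ℂ).re * (fourier 1 (x 1) : ℂ).im * (fourier 1 (x 2) : ℂ).re), (0 : ℝ)]

/-- A state `u ∈ H` is a MIRROR STATE (K-symmetric a.e., on its representative): for the three
coordinate reflections `R_i : x_i ↦ −x_i`, `u (R_i x) = R_i (u x)` a.e., written coordinatewise —
verbatim the crux's symmetry clause. -/
def IsMirrorState (u : H3) : Prop :=
  ∀ i j : Fin 3, (fun x => ((u : L2) : Vec3) (Function.update x i (-x i)) j) =ᵐ[volume]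
    (fun x => if j = i then -(((u : L2) : Vec3) x j) else ((u : L2) : Vec3) x j)

/-- The MIRROR CLASS `Fix K ⊆ H` (the carrier of the crux's certificate, before the energy cut). -/
def mirrorSlab : Set H3 := {u | IsMirrorState u}

/-- Spectral enstrophy `‖∇u‖² ∈ [0, ∞]` of a state `u ∈ H`. -/
def ens (u : H3) : ℝ≥0∞ := Torus.eGradNormSq ((u : L2) : Vec3)

/-- Viscous dissipation `D = ν‖∇u‖²` (`toReal`; junk `0` at infinite enstrophy, never used there). -/
def diss (ν : ℝ) (u : H3) : ℝ := ν * (ens u).toReal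

/-- The tested generator `⟨F_ν(u), Φ'(u)⟩` of a cylindrical functional. -/
def gen (ν : ℝ) (f : Vec3) (Φ : Torus.CylindricalTest (Fin 3)) (u : H3) : ℝ :=
  Torus.nsGeneratorPairing ν f u (Φ.grad u)

/-- The energy input `(u, f)`. -/
def work (f : Vec3) (u : H3) : ℝ := Torus.pairing (u : L2) f

/-- The FLOOR LAGRANGIAN `L_{Φ,θ}(u) = D + ⟨F_ν(u),Φ'(u)⟩ + 2θ((u,f) − D)` — literally the right-hand
side of the crux. -/
def lagrangian (ν : ℝ) (f : Vec3) (Φ : Torus.CylindricalTest (Fin 3)) (θ : ℝ) (u : H3) : ℝ :=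
  diss ν u + gen ν f Φ u + 2 * θ * (work f u - diss ν u)

/-- `(Φ, θ)` CERTIFIES THE FLOOR `ε` at viscosity `ν` ON THE SET `S` below the energy level `ρ`:
`θ ≤ 0` and the floor inequality holds at every finite-enstrophy state of `S ∩ {|u|² ≤ ρ}` (the inner
clause of the crux, with the carrier and the level as parameters). -/
def CertifiesFloorOn (ν ρ ε : ℝ) (f : Vec3) (S : Set H3) (Φ : Torus.CylindricalTest (Fin 3))
    (θ : ℝ) : Prop :=
  θ ≤ 0 ∧ ∀ u ∈ S, ens u ≠ ⊤ → ‖u‖ ^ 2 ≤ ρ → ε ≤ lagrangian ν f Φ θ u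

/-- **RELAXED STATIONARY STATISTIC of `NS_ν(f)` ON `S` below energy `ρ`** — the exact dual object of
the certificate class `CertifiesFloorOn ν ρ · f S`: a Borel probability measure on `H` carried by
`S ∩ {|u|² ≤ ρ}`, of finite mean enstrophy, annihilating every cylindrical Liouville functional (dual
to the free multiplier `Φ`), with integrable work and the ONE global mean energy inequality
`ν∫‖∇u‖²dμ ≤ ∫(u,f)dμ` (dual to `θ ≤ 0`). For `S = Fix K`: a relaxed stationary K-STATISTIC.
Contains (for `f` smooth, `ν > 0`) every FMRT stationary statistical solution carried by
`S ∩ ball` — Dirac masses at finite-enstrophy steady weak states in `S`, generalized time-average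
measures of Leray–Hopf solutions whose lift stays in `S ∩ ball` (tree
`timeAverage_isStationary_holds`) — and is strictly larger (no shell-wise inequalities (1.31)). -/
structure IsRelaxedSSSOn (ν ρ : ℝ) (f : Vec3) (S : Set H3) (μ : Measure H3) : Prop where
  prob : IsProbabilityMeasure μ
  ae_mem : ∀ᵐ u ∂μ, u ∈ S
  ae_ball : ∀ᵐ u ∂μ, ‖u‖ ^ 2 ≤ ρ
  enstrophy_finite : ∫⁻ u, ens u ∂μ < ⊤
  liouville : ∀ Φ : Torus.CylindricalTest (Fin 3), Integrable (gen ν f Φ) μ ∧ ∫ u, gen ν f Φ u ∂μ = 0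
  work_integrable : Integrable (work f) μ
  energy_ineq : Torus.ensembleDissipation ν μ ≤ ∫ u, work f u ∂μ

/-! ## The stub statements -/

/-- **S1 — STRONG DUALITY FOR FLOORS ON A CLOSED CARRIER INSIDE A BALL.** For `ν > 0`, a level `ρ`,
a floor `ε`, a force `f ∈ L²` and a CLOSED set `S ⊆ H`: if every relaxed stationary statistic of
`NS_ν(f)` on `S` below energy `ρ` has mean dissipation `≥ ε`, then for every margin `δ > 0` some
cylindrical `Φ` and weight `θ ≤ 0` certify the floor `ε − δ` at every finite-enstrophy state of
`S ∩ {|u|² ≤ ρ}`. (`S = univ`, `ρ = 16‖f‖²/ν²` is the sibling line's `FloorMinimax`.) -/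
def FloorMinimaxOn : Prop :=
  ∀ (ν ρ ε : ℝ) (f : Vec3) (S : Set H3), 0 < ν → MemLp f 2 (volume : Measure (UnitAddTorus (Fin 3))) →
    IsClosed S →
    (∀ μ : Measure H3, IsRelaxedSSSOn ν ρ f S μ → ε ≤ Torus.ensembleDissipation ν μ) →
    ∀ δ : ℝ, 0 < δ →
      ∃ (Φ : Torus.CylindricalTest (Fin 3)) (θ : ℝ), CertifiesFloorOn ν ρ (ε - δ) f S Φ θ

/-- **S2 — THE MIRROR CLASS IS CLOSED IN `H`.** -/
def MirrorSlabClosed : Prop := IsClosed mirrorSlab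

/-- **S3 — LOW-ENERGY RELAXED K-STATISTICS OF `f_TG` ARE LOUD (the transfer target `C⁺`; OPEN).** For
every energy level `E > 0` there are `ε₀, ν₀ > 0` such that for `ν ∈ (0, ν₀)` every relaxed
stationary K-statistic of `NS_ν(f_TG)` carried by `Fix K ∩ {|u|² ≤ E}` dissipates at least `ε₀` in
the mean: NO QUIET INVARIANT K-LAW below any fixed energy as `ν → 0`. -/
def MirrorLawsLoudTG : Prop :=
  ∀ E : ℝ, 0 < E → ∃ ε₀ ν₀ : ℝ, 0 < ε₀ ∧ 0 < ν₀ ∧ ∀ ν : ℝ, 0 < ν → ν < ν₀ →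
    ∀ μ : Measure H3, IsRelaxedSSSOn ν E tgForce mirrorSlab μ → ε₀ ≤ Torus.ensembleDissipation ν μ

/-! ## The stubs S1–S3 (the only `sorry`s of the file) -/

/-- **S1 `stub_floorMinimaxOn`** — size L, provable now; SHARED with the sibling crux line
`FloorCertificate/Lines/floor-minimax-dissipation-tightness` (its S1 `DissipationSublevelCompact`,
S2 `FanMinimax`, S3 `LopsidedMinimax`, S4 `CylindricalCombination`, S5 `FloorMinimax` — prove once,
with the closed ball `{|u|² ≤ ρ}` replaced by the closed set `S ∩ {|u|² ≤ ρ}`). WHY TRUE: fix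
`ν > 0, ρ, ε, f, S, δ`. GAME: `X := {μ : ProbabilityMeasure H // μ-a.e. u ∈ S ∧ |u|² ≤ ρ, ∫⁻‖∇u‖²dμ < ∞}`,
`Y := {(Φ, θ) : θ ≤ 0}`, payoff `φ(μ,(Φ,θ)) := ∫ L_{Φ,θ} dμ = (1 − 2θ)·ν(∫⁻‖∇u‖²dμ).toReal +
∫⟨F_ν,Φ'⟩dμ + 2θ∫(u,f)dμ`. The generator term and the work are CONTINUOUS on `H` and BOUNDED on the
ball for `f ∈ L²` (tree `Torus.continuous_nsGeneratorPairing_grad` (needs `Integrable f`),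
`Torus.exists_abs_nsGeneratorPairing_grad_le` (needs `MemLp f 2`): `|⟨F,Φ'⟩| ≤ K(1+ρ)`;
`Torus.continuous_pairing_coe`, `Torus.abs_pairing_coe_le`: `|(u,f)| ≤ √ρ‖f‖`), hence continuous in
`μ ∈ X` for the weak topology (truncate at the bound); the enstrophy term is lsc in `μ` (lsc
nonnegative integrand, tree `Torus.lowerSemicontinuous_eGradNormSq_coe`; `1 − 2θ ≥ 1`). `φ` is affine
in `μ` (convex-like) and concave-like in `(Φ,θ)` ON THE BALL (the cylindrical class realises
`tΦ₁' + (1−t)Φ₂'` on every ball by one functional after a `C¹_c` re-cut-off — sibling S4 — and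
`Torus.nsGeneratorPairing_sum_smul`). INF-COMPACTNESS at `y₀ = (Φ_zero, 0)`: the sublevel set
`{μ ∈ X : ν∫‖∇u‖²dμ ≤ c}` is TIGHT (Markov + Rellich: tree `Torus.isCompact_setOf_eGradNormSq_le`
intersected with the closed ball; `KrylovBogoliubov.isTightMeasureSet_of_lintegral_le`), hence
relatively compact (Mathlib Prokhorov `isCompact_closure_of_isTightMeasureSet`; `H` separable metric,
Borel), and CLOSED: "carried by the CLOSED set `S ∩ ball`" passes to weak limits (portmanteau,
`limsup μₙ(F) ≤ μ(F)` for closed `F` — THIS is where `IsClosed S` enters) and `μ ↦ ∫⁻‖∇u‖²dμ` is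
lsc. The LOPSIDED minimax (Ky Fan's convex-like minimax upgraded by the finite-intersection argument
from "`X` compact" to "inf-compact at one `y₀`": Aubin, Optima and Equilibria, Thm 8.1 / Prop.
8.2–8.3; sibling S2–S3) exchanges `sup` and `inf` at the level `γ := ε − δ`: every `μ ∈ X` is beaten
above `γ` — if `μ` is relaxed stationary, `φ(μ,y₀) = ν∫‖∇u‖²dμ ≥ ε > γ` by hypothesis; if some
Liouville integral `∫⟨F,Φ'⟩dμ = c ≠ 0`, scale `Φ` (`φ → +∞`); if the energy inequality fails by
`d > 0`, send `θ → −∞` (`φ = ν∫‖∇u‖² + 2|θ|d → +∞`); these exhaust `¬IsRelaxedSSSOn` on `X`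
(probability, carrier, finite enstrophy and the integrabilities hold automatically there). Hence ONE
`(Φ, θ ≤ 0)` with `φ(μ,(Φ,θ)) > γ` on `X`; evaluate at DIRAC masses `δ_u`, `u ∈ S`, `|u|² ≤ ρ`, finite
enstrophy (`δ_u ∈ X`: `ae_dirac_iff` with the closed, hence measurable, `S ∩ ball`;
`lintegral_dirac'` with `Torus.measurable_eGradNormSq_coe`; `integral_dirac`): `L_{Φ,θ}(u) > ε − δ`,
i.e. `CertifiesFloorOn ν ρ (ε − δ) f S Φ θ`. ∎ For `ρ < 0` or `S ∩ ball = ∅` every `(Φ, 0)` certifies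
vacuously. Finite-dimensional shadow: Tobasco–Goluskin–Doering (tree
`TobascoGoluskinDoering2018_measureForm`); symmetry-reduced SOS bounds: Goluskin–Fantuzzi.
Leans on: sibling S1–S4, `CylindricalGenerator`, `StatisticalSolutionEnergyEq`, `EnergySpaceRellich`,
Mathlib `ProbabilityMeasure` / `Prokhorov` / `Portmanteau` / `Measure.dirac`.
[arXiv:2010.06730 Thm 4.1, Thm 6.2, Rem 6.1–6.2; arXiv:1705.07096; doi:10.1088/1361-6544/ab018b;
FMRTTurbulence2001 Ch. IV §1; Fan, PNAS 39 (1953) Thm 2; Aubin 1993 Thm 8.1.] -/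
theorem stub_floorMinimaxOn : FloorMinimaxOn := by
  sorry

/-- **S2 `stub_mirrorSlabClosed`** — size S–M, provable now. WHY TRUE: `mirrorSlab = ⋂_{i,j} A_{ij}`
with `A_{ij} = {u ∈ H : (u ∘ σ_i)_j = (R_i u)_j a.e.}`, `σ_i x = update x i (−x i)`. Each `σ_i` is a
continuous group automorphism of `T³ = (Fin 3 → UnitAddCircle)` preserving the Haar/product
measure `volume` (negation on one `UnitAddCircle` factor is measure preserving:
`Measure.IsNegInvariant`/`measurePreserving_neg` on `AddCircle`, product via
`MeasureTheory.volume_preserving_pi`/`MeasurePreserving.pi`), so `u ↦ u ∘ σ_i` is a well-defined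
linear ISOMETRY of `L²(T³; ℝ³)` (`Lp.compMeasurePreserving`), and `u ↦ R_i ∘ u` (sign flip of the
`i`-th component) is a linear isometry too; `A_{ij}` is the equaliser of the `j`-th components of two
continuous linear maps `L² → L²`, read through the continuous coordinate functional — a closed set;
or directly: if `uₙ → u` in `L²` with `uₙ ∈ A_{ij}`, a subsequence converges a.e.
(`MeasureTheory.Lp.tendsto_Lp_iff_tendsto_eLpNorm'` + `TendstoInMeasure.exists_seq_tendsto_ae`), and so
does `uₙ ∘ σ_i → u ∘ σ_i` a.e. (`MeasurePreserving.quasiMeasurePreserving`, `ae_map_iff`); pass to the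
limit in the a.e. identity. The subtype topology of `H ⊆ L²` is the induced one, so closedness in `L²`
gives closedness in `H` (`IsClosed.preimage continuous_subtype_val`). The same reflections are
`Literature.Analysis.FluidPDE.mirrorReflection i` (OctahedralSymmetry.lean, `mirrorReflection_apply`);
MirrorVariety's Fix-K Galerkin vocabulary (`Theorems/TaylorGreenLoudGalerkinStates/Negative/Anatomy`)
has the finite-dimensional twin. Leans on: Mathlib `Lp.compMeasurePreserving`,
`MeasurePreserving` API on `AddCircle`/pi types, `ae` calculus.
[doi:10.1017/s0022112083001159 §2 (the TG symmetry group); FMRTTurbulence2001 Ch. IV §1.1.] -/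
theorem stub_mirrorSlabClosed : MirrorSlabClosed := by
  sorry

/-- **S3 `stub_mirrorLawsLoudTG`** — OPEN (the bet; HARDEST; the crux's entire physical content in
dual form: the LOW-ENERGY ENSEMBLE ZEROTH LAW IN THE MIRROR CLASS for the pinned force `f_TG`).
WHY IT MIGHT FAIL (= the crux's): ONE quiet relaxed stationary K-statistic below energy `E` along
`ν_j → 0` kills it at that `E` — a Dirac mass at a quiet bounded steady K-state (steady corner
line-jet of width `√ν` carrying the Kelvin flux `4/π` at dissipation `O(ν)`; a steady branch
shadowing `A(ν)·`(planar TG cell), `A ~ ν^{-1/3}`), the time average of a quiet eruption cycle, or a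
quiet relaxed-but-not-dynamical measure exploiting the ONE global energy inequality (a "leaky"
statistic: `∫(u,f)dμ ≫ ν∫‖∇u‖²dμ`; cf. the sibling line's proved INPUT/LEAK split). WHY IT MIGHT
HOLD / WHAT THE DUAL FORM BUYS: (i) atoms are exact steady weak K-states, so the finitely supported
case IS the route's support `MirrorSteadyStatesLoudTG`, and by `KelvinPumpSteadyTG` every smooth
steady K-state obeys the `ν`-independent identity `ν∮_C Δu·dl = −4/π` on the symmetry-pinned face
loop (a quiet bounded steady branch is a singular-perturbation object located in advance: `1/ν`
curvature on the skeleton at bounded energy); (ii) no smooth quiet Euler K-point of `f_TG` exists at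
ANY energy (`NoSmoothMirrorDodgerTG`, Kelvin pump `∮_C f_TG·dl = 4/π ≠ 0`), so the catalogued
quiet-point kills have no instance in `Fix K`; (iii) every cylindrical `Φ` is an exact linear
constraint on the class: with `Φ = (u, f_TG)` (admissible: `f_TG ∈ 𝒱`, `Δf_TG = −12π²f_TG`),
`‖f_TG‖² = 12π²ν∫(u,f_TG)dμ + ∫ b(u,u,f_TG)dμ`, and `|(u,f_TG)| ≤ √E/2`, so as `ν → 0` quiet or not
every K-law below `E` carries the full triple correlation `∫b(u,u,f_TG)dμ → ‖f_TG‖² = 1/4` — the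
statistics cannot hide near rest, shear flows / Beltrami rays / drifts are not in `Fix K` by parity,
and planar TG cells are not invariant (`f_TG ∝ cos 2πx₂`); (iv) the class is convex, narrowly closed
at fixed `ν` and the slab is bounded, so a minimising (quietest) K-statistic EXISTS at each `ν` (S1's
inf-compactness) — the enemy is one concrete measure per `ν`, not a family of approximate dodgers.
EXACTNESS: `MirrorFloorTG → MirrorLawsLoudTG` by weak duality on the slab (integrate the floor
against `μ`; the sibling's `weak_duality` verbatim with the ball replaced by the slab), so S3 is
NECESSARY for the crux and, given S1–S2, equivalent to it. Cheapest falsifier (= route header (ii)):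
deflated-Newton / `ν`-continuation census of steady K-symmetric Galerkin states of `f_TG` in
MirrorVariety's Fix-K machinery (`N ≤ 24`, `ν ∈ [10⁻³,10⁻¹]`): a branch with `∫|U|²` bounded and
`ν‖∇U‖² → 0` is a Dirac counterexample in the making. Barriers: Cheskidov2023 (force-robust
no-anomaly) — not in class (exact in `f_TG`); AlexakisDoering2006 — planar members of `Fix K` are not
invariant; Marchioro1986 — no laminar target in `Fix K` (Stokes response is not steady); an unknown
3-D fat K-attractor below `E` would refute S3 honestly. [arXiv:1705.07096; arXiv:2010.06730;
FMRTTurbulence2001 IV–V; doi:10.1098/rsta.2013.0350; doi:10.1017/s0022112083001159;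
doi:10.1357/002224004774201681; doi:10.1103/physreve.77.036306.] -/
theorem stub_mirrorLawsLoudTG : MirrorLawsLoudTG := by
  sorry

/-! ## Name-keyed aliases of the three statements — the hypotheses of `MirrorFloorTG_of`

The native skeleton audit (`#h21_check_skeleton`, run by `ledger skeleton check`) admits a hypothesis of the
composing theorem only if its head constant is a registered obligation or is NAMED like a declared stub;
`__Registered.stub_X` is statement `X` under the registered stub's short name (device of
`RiemannHypothesis/…/Cruxes/MediumKernelNoGo/Lines/pencil_bracket_count.lean` and
`CriticalPhenomena/…/Lines/finite_size_envelope.lean`; the `__` namespace is an implementation detail, so the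
audit's stub report resolves each `stub_…` to the sorried theorem, not to its alias; the gate-reserved
`@[stub]` attribute is not written by a planner). Each alias is an `abbrev`, definitionally its statement. -/
namespace __Registered

/-- Alias of `FloorMinimaxOn` keyed by the registered stub name. -/
abbrev stub_floorMinimaxOn : Prop := FloorMinimaxOn
/-- Alias of `MirrorSlabClosed` keyed by the registered stub name. -/
abbrev stub_mirrorSlabClosed : Prop := MirrorSlabClosed
/-- Alias of `MirrorLawsLoudTG` keyed by the registered stub name. -/
abbrev stub_mirrorLawsLoudTG : Prop := MirrorLawsLoudTG

end __Registered

/-! ## Proved: the vocabulary is the crux, `f_TG ∈ L²`, and the composition -/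

/-- **The vocabulary is DEFINITIONALLY the crux**: `MirrorFloorTG` says that for every `E > 0` some
`(ε₀, ν₀)` work such that at every `ν ∈ (0, ν₀)` some `(Φ, θ)` certifies the floor `ε₀` on the mirror
class below energy `E`, for the pinned force. -/
theorem mirrorFloorTG_iff :
    MirrorFloorTG ↔
      ∀ E : ℝ, 0 < E → ∃ ε₀ ν₀ : ℝ, 0 < ε₀ ∧ 0 < ν₀ ∧ ∀ ν : ℝ, 0 < ν → ν < ν₀ →
        ∃ (Φ : Torus.CylindricalTest (Fin 3)) (θ : ℝ), CertifiesFloorOn ν E ε₀ tgForce mirrorSlab Φ θ := by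
  constructor
  · intro h
    exact h tgForce rfl
  · intro h f hf
    subst hf
    exact h

/-- `f_TG` is the real trigonometric polynomial on the shell `{±1}³` with coefficients
`(1/8)(−i k₀, i k₁, 0)` (MirrorVariety `Negative/Anatomy`; the route's `closes`, verbatim). -/
theorem tgForce_eq_realTrigPoly :
    tgForce = Torus.realTrigPoly (Fintype.piFinset fun _ : Fin 3 => ({1, -1} : Finset ℤ))
      (fun k => ((8⁻¹ : ℝ) : ℂ) • !₂[-(Complex.I * (k 0 : ℂ)), Complex.I * (k 1 : ℂ), 0]) := by
  set fTG : Vec3 := tgForce with hfTG'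
  have hfTG : fTG = fun x => !₂[(fourier 1 (x 0) : ℂ).im * (fourier 1 (x 1) : ℂ).re * (fourier 1 (x 2) : ℂ).re,
      -((fourier 1 (x 0) : ℂ).re * (fourier 1 (x 1) : ℂ).im * (fourier 1 (x 2) : ℂ).re), (0 : ℝ)] := rfl
  set S : Finset (Fin 3 → ℤ) := Fintype.piFinset fun _ : Fin 3 => ({1, -1} : Finset ℤ) with hS
  set C : (Fin 3 → ℤ) → EuclideanSpace ℂ (Fin 3) :=
    fun k => ((8⁻¹ : ℝ) : ℂ) • !₂[-(Complex.I * (k 0 : ℂ)), Complex.I * (k 1 : ℂ), 0] with hC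
  have hsp : ∀ g : Fin 3 → ℤ → ℂ, ∑ k ∈ S, ∏ j, g j (k j) = ∏ j, (g j 1 + g j (-1)) := by
    intro g
    rw [hS, ← Finset.prod_univ_sum]
    exact Finset.prod_congr rfl fun j _ => Finset.sum_pair (by decide)
  have hmF3 : ∀ (k : Fin 3 → ℤ) (x : UnitAddTorus (Fin 3)),
      UnitAddTorus.mFourier k x = fourier (k 0) (x 0) * fourier (k 1) (x 1) * fourier (k 2) (x 2) := by
    intro k x; simp [UnitAddTorus.mFourier, Fin.prod_univ_three]
  have ha0 : ∀ x : UnitAddTorus (Fin 3), (∑ k ∈ S, UnitAddTorus.mFourier k x * C k 0).re = fTG x 0 := by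
    intro x
    have h : ∀ k ∈ S, UnitAddTorus.mFourier k x * C k 0 =
        ∏ j, (![fun a : ℤ => fourier a (x 0) * (((8⁻¹ : ℝ) : ℂ) * -(Complex.I * (a : ℂ))),
          fun a : ℤ => (fourier a (x 1) : ℂ), fun a : ℤ => (fourier a (x 2) : ℂ)] : Fin 3 → ℤ → ℂ) j (k j) := by
      intro k _
      rw [hmF3, Fin.prod_univ_three]
      simp [hC]
      ring
    rw [Finset.sum_congr rfl h, hsp, Fin.prod_univ_three]
    simp only [Matrix.cons_val_zero, Matrix.cons_val_one, Matrix.cons_val_two, Matrix.head_cons, Matrix.tail_cons,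
      fourier_neg, Int.cast_one, Int.cast_neg, hfTG, PiLp.toLp_apply]
    simp only [Complex.mul_re, Complex.mul_im, Complex.add_re, Complex.add_im, Complex.neg_re, Complex.neg_im,
      Complex.conj_re, Complex.conj_im, Complex.I_re, Complex.I_im, Complex.ofReal_re, Complex.ofReal_im,
      Complex.one_re, Complex.one_im, zero_mul, sub_zero, zero_sub, add_zero, zero_add, mul_one, one_mul]
    ring
  have ha1 : ∀ x : UnitAddTorus (Fin 3), (∑ k ∈ S, UnitAddTorus.mFourier k x * C k 1).re = fTG x 1 := by
    intro x
    have h : ∀ k ∈ S, UnitAddTorus.mFourier k x * C k 1 =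
        ∏ j, (![fun a : ℤ => (fourier a (x 0) : ℂ),
          fun a : ℤ => fourier a (x 1) * (((8⁻¹ : ℝ) : ℂ) * (Complex.I * (a : ℂ))),
          fun a : ℤ => (fourier a (x 2) : ℂ)] : Fin 3 → ℤ → ℂ) j (k j) := by
      intro k _
      rw [hmF3, Fin.prod_univ_three]
      simp [hC]
      ring
    rw [Finset.sum_congr rfl h, hsp, Fin.prod_univ_three]
    simp only [Matrix.cons_val_zero, Matrix.cons_val_one, Matrix.cons_val_two, Matrix.head_cons, Matrix.tail_cons,
      fourier_neg, Int.cast_one, Int.cast_neg, hfTG, PiLp.toLp_apply]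
    simp only [Complex.mul_re, Complex.mul_im, Complex.add_re, Complex.add_im, Complex.neg_re, Complex.neg_im,
      Complex.conj_re, Complex.conj_im, Complex.I_re, Complex.I_im, Complex.ofReal_re, Complex.ofReal_im,
      Complex.one_re, Complex.one_im, zero_mul, sub_zero, zero_sub, add_zero, zero_add, mul_one, one_mul]
    ring
  have ha2 : ∀ x : UnitAddTorus (Fin 3), (∑ k ∈ S, UnitAddTorus.mFourier k x * C k 2).re = fTG x 2 :=
    fun x => by simp [hC, hfTG]
  funext x
  ext i
  rw [Torus.realTrigPoly_apply_coord, Torus.trigPoly_apply_coord]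
  fin_cases i
  · exact (ha0 x).symm
  · exact (ha1 x).symm
  · exact (ha2 x).symm

/-- `f_TG` is smooth (a real trigonometric polynomial). -/
theorem isSmooth_tgForce : Torus.IsSmooth tgForce :=
  tgForce_eq_realTrigPoly ▸ Torus.isSmooth_realTrigPoly _ _

/-- `f_TG ∈ L²(T³; ℝ³)` — the admissibility S1 asks of the force. -/
theorem memLp_tgForce : MemLp tgForce 2 (volume : Measure (UnitAddTorus (Fin 3))) :=
  isSmooth_tgForce.memLp 2

/-! ## The composition: `MirrorFloorTG` from S1–S3 (kernel-checked; no `sorry` of its own) -/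

/-- **`MirrorFloorTG` from the three stub statements.** Given `E > 0`, S3 supplies
`(ε₀, ν₀)` such that every relaxed stationary K-statistic of `NS_ν(f_TG)` below energy `E`
dissipates `≥ ε₀` for `ν ∈ (0, ν₀)`; S1 (fed the closed mirror class from S2 and `f_TG ∈ L²`) with
margin `δ = ε₀/2` hands over `(Φ, θ ≤ 0)` certifying `ε₀ − ε₀/2 = ε₀/2` at every finite-enstrophy
mirror state below energy `E` — verbatim the crux at level `E` with the answer `(ε₀/2, ν₀)`. -/
theorem MirrorFloorTG_of :
    __Registered.stub_floorMinimaxOn → __Registered.stub_mirrorSlabClosed →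
      __Registered.stub_mirrorLawsLoudTG → MirrorFloorTG := by
  intro hMM hcl hloud
  rw [mirrorFloorTG_iff]
  intro E hE
  obtain ⟨ε₀, ν₀, hε₀, hν₀, hL⟩ := hloud E hE
  refine ⟨ε₀ / 2, ν₀, half_pos hε₀, hν₀, fun ν hν hνlt => ?_⟩
  obtain ⟨Φ, θ, hθ, hfloor⟩ :=
    hMM ν E ε₀ tgForce mirrorSlab hν memLp_tgForce hcl (hL ν hν hνlt) (ε₀ / 2) (half_pos hε₀)
  refine ⟨Φ, θ, hθ, fun u hu hfin hball => ?_⟩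
  have h := hfloor u hu hfin hball
  linarith

/-- WIRING CHECK: the three sorried stubs compose to a closed term of the crux's type (modulo their
`sorry`s). Deliberately an `example` (no constant enters the environment), so that a BC3 probe
importing this file cannot close `stub → MirrorFloorTG` by `exact?` through a pre-composed witness. -/
example : MirrorFloorTG :=
  MirrorFloorTG_of stub_floorMinimaxOn stub_mirrorSlabClosed stub_mirrorLawsLoudTG

end Summit.AnomalousDissipation.AnomalousDissipation.Cruxes.MirrorFloorTG.Birth

end
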